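import Mathlib
import Summits.NavierStokesRegularity.NavierStokesRegularity.Theorems.EulerZoomLiouvillePowerGaugeEulerLiouvilleDriftClockTools
import HarnessLib

/-!
# «NO RETURN AFTER SLOW OUTFLOW», ABSOLUTE FORM: the signed absolute band bootstrap and the absolute no-return lemma (class-free ODE tools)
# (crux `EulerZoomLiouville.PowerGaugeEulerLiouville` = stmt-NavierStokesRegularity-19832, THE ONE STATEMENT `stub_selfSimilarC2Needle`;
# RESIDUE-MEMO-19832-g13 §3 target T-C in the ABSOLUTE band of `HasFastVorticalChannel` alternative 4 — width seat ns-ezl-w1 g6 for the LEAD ns-typeII-p2 g13)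

Route `EulerZoomLiouville` (NavierStokesRegularity), crux E.  Class-free calculus/ODE lemmas (no budgets, no profile equation); the absolute-rate twin of
`…BandClockNoReturn` (this seat), built on the LEAD's `…DriftClockTools`.  For a `C¹` field `V` on `ℝ³` let `W y = γy + V y` (`selfSimilarTransport γ 0 V`),
`ℛ(y) = ⟪y, W y⟫` (ABSOLUTE radial rate), `a(y) = ‖W y‖² + γ⟪y, W y⟫ + ⟪y, DV(y)(W y)⟫`; along a BACKWARD arc `Z′ = −W(Z)`: `(ℛ∘Z)′ = −a(Z)` exactly,
`(‖Z‖²)′ = −2ℛ(Z)`.  The LEAD's `DriftClock.abs_band_bootstrap` starts in the INFLOW half-band (`m₀ ≥ 0`).  Here: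

* **`DriftClock.signed_abs_band_bootstrap`** — SIGNED start `−κb ≤ m₀` under the FULL ABSOLUTE BAND deficit (`a(y) ≥ a₀` at every far vortical high point with
  `|ℛ(y)| ≤ κb`): along a high vortical backward arc on `[t₀, t₁]` with `ℛ(Z t₀) + m₀ ≤ 0`, slope `0 ≤ k < a₀`, `m₀ + k(t₁ − t₀) ≤ κb`, and
  `R₁² + 2κb(t₁ − t₀) ≤ ‖Z t₀‖²`, for all `s ∈ [t₀, t₁]`: `ℛ(Z s) + (m₀ + k(s − t₀)) ≤ 0` AND the linear floor `‖Z t₀‖² ≤ ‖Z s‖² + 2κb(s − t₀)`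
  (the radius² shrinks at most at rate `2κb` while `ℛ ≤ κb`).  Continuous induction: at a tight point `ℛ = −m ∈ [−κb, κb]` the point is IN THE BAND, so
  `(ℛ + m)′ = −a + k ≤ k − a₀ < 0`; the floor persists because `ℛ ≤ −m ≤ κb` makes `‖Z‖² + 2κb s` non-decreasing.
* **`DriftClock.abs_noReturn`** — ABSOLUTE NO RETURN: under the full absolute band deficit beyond `R₁`, a high vortical backward arc on `[t₀, t₁]` (any length)
  starting with `ℛ(Z t₀) ≤ κb` (slow outflow or any inflow) and `R₁² + 4κb²/a₀ ≤ ‖Z t₀‖²` keeps `‖Z s‖² ≥ ‖Z t₀‖² − 4κb²/a₀ (≥ R₁²)` for ALL `s`, and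
  `ℛ(Z s) ≤ 0` from `s = t₀ + 2κb/a₀` on: phase 0 = the signed bootstrap with `m₀ = −κb`, `k = a₀/2` on `[t₀, t₀ + 2κb/a₀]`, then the LEAD's
  `abs_band_bootstrap` with `m₀ = 0`, `k = 0` (radius non-decreasing).  The near-origin loophole (memo §2) is closed in the absolute-deficit class of
  alternative 4: after `‖y‖² ≥ R₁² + 4κb²/a₀` the backward orbit never sees `B(0, R₁)` again.

WHAT THIS IS NOT: not NS, not E — class-free ODE lemmas `--supports` stmt-19832 (the member-level use is the LEAD's T-D «spikes or hovering»); the crux is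
OPEN; NS regularity is NOT proved; no summit statement is proved by this seat. [folklore; cf. ConstantinIgnatovaVicol2026Putative §3.4 (3.19)–(3.20)]
-/

noncomputable section

-- flat `Theorems/<Route><Decl>…` files of one crux share the namespace of the crux (tree convention: `Summit.<S>.<S>.…`)
set_option linter.dupNamespace false

open Set Filter Topology Metric
open scoped RealInnerProductSpace

namespace Summit.NavierStokesRegularity.NavierStokesRegularity.Theorems.PowerGaugeEulerLiouville

open Literature.Analysis Literature.Analysis.FluidPDE

namespace DriftClock

variable {γ : ℝ} {V : EuclideanSpace ℝ (Fin 3) → EuclideanSpace ℝ (Fin 3)} {P' : EuclideanSpace ℝ (Fin 3) → ℝ}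

/-- **THE SIGNED ABSOLUTE BAND BOOTSTRAP** (see the module docstring).  `V ∈ C¹`; backward arc `Z′ = −W(Z)` on `[t₀, t₁]`, high and vortical throughout;
FULL ABSOLUTE BAND deficit beyond `R₁` (`|ℛ| ≤ κb ⇒ a ≥ a₀`); signed start `−κb ≤ m₀`, slope `0 ≤ k < a₀`, `m₀ + k(t₁ − t₀) ≤ κb`; `ℛ(Z t₀) + m₀ ≤ 0`;
`R₁² + 2κb(t₁ − t₀) ≤ ‖Z t₀‖²`.  Then on `[t₀, t₁]`: `‖Z t₀‖² ≤ ‖Z s‖² + 2κb(s − t₀)` and `ℛ(Z s) + (m₀ + k(s − t₀)) ≤ 0`. [folklore] -/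
theorem signed_abs_band_bootstrap (hV : ContDiff ℝ 1 V) {κb a₀ R₁ h t₀ t₁ m₀ k : ℝ} (hκb : 0 < κb) (hR₁ : 0 < R₁)
    (ht : t₀ ≤ t₁) (hm₀ : -κb ≤ m₀) (hk0 : 0 ≤ k) (hka : k < a₀) (hmc : m₀ + k * (t₁ - t₀) ≤ κb)
    (hdef : ∀ y : EuclideanSpace ℝ (Fin 3), R₁ ≤ ‖y‖ → h < selfSimilarBernoulli γ 0 V P' y → curl V y ≠ 0 →
      -κb ≤ ⟪y, selfSimilarTransport γ 0 V y⟫ → ⟪y, selfSimilarTransport γ 0 V y⟫ ≤ κb →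
      a₀ ≤ ‖selfSimilarTransport γ 0 V y‖ ^ 2 + γ * ⟪y, selfSimilarTransport γ 0 V y⟫ +
        ⟪y, fderiv ℝ V y (selfSimilarTransport γ 0 V y)⟫)
    {Z : ℝ → EuclideanSpace ℝ (Fin 3)}
    (hZ : ∀ s ∈ Icc t₀ t₁, HasDerivAt Z (-(selfSimilarTransport γ 0 V (Z s))) s)
    (hhigh : ∀ s ∈ Icc t₀ t₁, h < selfSimilarBernoulli γ 0 V P' (Z s))
    (hvort : ∀ s ∈ Icc t₀ t₁, curl V (Z s) ≠ 0)
    (hZ0 : R₁ ^ 2 + 2 * κb * (t₁ - t₀) ≤ ‖Z t₀‖ ^ 2)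
    (hrate0 : ⟪Z t₀, selfSimilarTransport γ 0 V (Z t₀)⟫ + m₀ ≤ 0) :
    ∀ s ∈ Icc t₀ t₁, ‖Z t₀‖ ^ 2 ≤ ‖Z s‖ ^ 2 + 2 * κb * (s - t₀) ∧
      ⟪Z s, selfSimilarTransport γ 0 V (Z s)⟫ + (m₀ + k * (s - t₀)) ≤ 0 := by
  -- notation
  set W := selfSimilarTransport γ 0 V with hWdef
  set ℛ : ℝ → ℝ := fun s => ⟪Z s, W (Z s)⟫ with hℛdef
  set N : ℝ → ℝ := fun s => ‖Z s‖ ^ 2 with hNdef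
  set E : ℝ → ℝ := fun s => N s + 2 * κb * (s - t₀) with hEdef
  set m : ℝ → ℝ := fun s => m₀ + k * (s - t₀) with hmdef
  set ψ : ℝ → ℝ := fun s => ℛ s + m s with hψdef
  -- derivatives along the arc
  have hℛd : ∀ s ∈ Icc t₀ t₁, HasDerivAt ℛ
      (-(‖W (Z s)‖ ^ 2 + γ * ⟪Z s, W (Z s)⟫ + ⟪Z s, fderiv ℝ V (Z s) (W (Z s))⟫)) s :=
    fun s hs => BandClock.hasDerivAt_radialRate_comp (γ := γ) hV (hZ s hs)
  have hNd : ∀ s ∈ Icc t₀ t₁, HasDerivAt N (2 * ⟪Z s, -(W (Z s))⟫) s := fun s hs => (hZ s hs).norm_sq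
  have hlin : ∀ s, HasDerivAt (fun s : ℝ => 2 * κb * (s - t₀)) (2 * κb) s := by
    intro s
    have := ((hasDerivAt_id s).sub_const t₀).const_mul (2 * κb)
    simpa using this
  have hEd : ∀ s ∈ Icc t₀ t₁, HasDerivAt E (2 * ⟪Z s, -(W (Z s))⟫ + 2 * κb) s :=
    fun s hs => (hNd s hs).add (hlin s)
  have hmd : ∀ s, HasDerivAt m k s := by
    intro s
    have := ((hasDerivAt_id s).sub_const t₀).const_mul k |>.const_add m₀
    simpa [hmdef] using this
  have hψd : ∀ s ∈ Icc t₀ t₁, HasDerivAt ψ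
      (-(‖W (Z s)‖ ^ 2 + γ * ⟪Z s, W (Z s)⟫ + ⟪Z s, fderiv ℝ V (Z s) (W (Z s))⟫) + k) s :=
    fun s hs => (hℛd s hs).add (hmd s)
  -- continuity on the arc
  have hEc : ContinuousOn E (Icc t₀ t₁) := fun s hs => (hEd s hs).continuousAt.continuousWithinAt
  have hψc : ContinuousOn ψ (Icc t₀ t₁) := fun s hs => (hψd s hs).continuousAt.continuousWithinAt
  -- slope bounds
  have hm_ge : ∀ s, t₀ ≤ s → -κb ≤ m s := fun s hs => by
    have : 0 ≤ k * (s - t₀) := mul_nonneg hk0 (by linarith)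
    simp only [hmdef]; linarith
  have hm_le : ∀ s, s ≤ t₁ → m s ≤ κb := fun s hs => by
    have : k * (s - t₀) ≤ k * (t₁ - t₀) := mul_le_mul_of_nonneg_left (by linarith) hk0
    simp only [hmdef]; linarith
  -- the floor keeps the arc beyond `R₁`
  have hfloorR : ∀ s ∈ Icc t₀ t₁, N t₀ ≤ E s → R₁ ≤ ‖Z s‖ := by
    intro s hs hE
    have hE' : ‖Z t₀‖ ^ 2 ≤ ‖Z s‖ ^ 2 + 2 * κb * (s - t₀) := hE
    have h1 : 2 * κb * (s - t₀) ≤ 2 * κb * (t₁ - t₀) := mul_le_mul_of_nonneg_left (by linarith [hs.2]) (by linarith)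
    have h2 : R₁ ^ 2 ≤ ‖Z s‖ ^ 2 := by linarith
    exact (pow_le_pow_iff_left₀ hR₁.le (norm_nonneg _) two_ne_zero).1 h2
  -- the good set and its supremum
  set good : ℝ → Prop := fun s => N t₀ ≤ E s ∧ ψ s ≤ 0 with hgooddef
  have hgood0 : good t₀ := by
    refine ⟨?_, ?_⟩
    · simp only [hEdef, hNdef, sub_self, mul_zero, add_zero]; exact le_rfl
    · simp only [hψdef, hmdef, hℛdef, sub_self, mul_zero, add_zero]; exact hrate0
  set G : Set ℝ := {s | s ∈ Icc t₀ t₁ ∧ ∀ s' ∈ Icc t₀ s, good s'} with hGdef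
  have hG0 : t₀ ∈ G := ⟨left_mem_Icc.2 ht, fun s' hs' => by
    have : s' = t₀ := le_antisymm hs'.2 hs'.1
    rw [this]; exact hgood0⟩
  have hGne : G.Nonempty := ⟨t₀, hG0⟩
  have hGbdd : BddAbove G := ⟨t₁, fun s hs => hs.1.2⟩
  set sstar := sSup G with hsdef
  have hs0 : t₀ ≤ sstar := le_csSup hGbdd hG0
  have hs1 : sstar ≤ t₁ := csSup_le hGne fun s hs => hs.1.2
  have hgood_lt : ∀ s, t₀ ≤ s → s < sstar → good s := by
    intro s hs0' hs
    obtain ⟨σ, hσG, hsσ⟩ := exists_lt_of_lt_csSup hGne hs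
    exact hσG.2 s ⟨hs0', hsσ.le⟩
  have hclosed : IsClosed {s | s ∈ Icc t₀ t₁ ∧ good s} := by
    have h1 : IsClosed {s | s ∈ Icc t₀ t₁ ∧ N t₀ ≤ E s} := by
      have := hEc.preimage_isClosed_of_isClosed isClosed_Icc (isClosed_Ici (a := N t₀))
      convert this using 1
      ext s; simp [Set.mem_preimage]
    have h2 : IsClosed {s | s ∈ Icc t₀ t₁ ∧ ψ s ≤ 0} := by
      have := hψc.preimage_isClosed_of_isClosed isClosed_Icc (isClosed_Iic (a := (0 : ℝ)))
      convert this using 1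
      ext s; simp [Set.mem_preimage]
    have e : {s | s ∈ Icc t₀ t₁ ∧ good s} = {s | s ∈ Icc t₀ t₁ ∧ N t₀ ≤ E s} ∩ {s | s ∈ Icc t₀ t₁ ∧ ψ s ≤ 0} := by
      ext s; simp only [hgooddef, mem_setOf_eq, mem_inter_iff]; tauto
    rw [e]; exact h1.inter h2
  have hgood_star : good sstar := by
    rcases hs0.lt_or_eq with hpos | hzero
    · have hsub : Ico t₀ sstar ⊆ {s | s ∈ Icc t₀ t₁ ∧ good s} := fun s hs =>
        ⟨⟨hs.1, le_trans hs.2.le hs1⟩, hgood_lt s hs.1 hs.2⟩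
      have hcl := hclosed.closure_subset_iff.2 hsub
      have hmem : sstar ∈ closure (Ico t₀ sstar) := by
        rw [closure_Ico hpos.ne]; exact right_mem_Icc.2 hs0
      exact (hcl hmem).2
    · rw [← hzero]; exact hgood0
  have hgood_le : ∀ s ∈ Icc t₀ sstar, good s := by
    intro s hs
    rcases hs.2.lt_or_eq with hl | he
    · exact hgood_lt s hs.1 hl
    · rw [he]; exact hgood_star
  -- ### the supremum is `t₁`
  have hstar : sstar = t₁ := by
    by_contra hne
    have hlt : sstar < t₁ := lt_of_le_of_ne hs1 hne
    have hmem : sstar ∈ Icc t₀ t₁ := ⟨hs0, hs1⟩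
    have hR₁le : R₁ ≤ ‖Z sstar‖ := hfloorR sstar hmem hgood_star.1
    have hm_le' : m sstar ≤ κb := hm_le sstar hs1
    have hm_ge' : -κb ≤ m sstar := hm_ge sstar hs0
    -- (1) `ψ < 0` just to the right of `sstar`
    have hψneg : ∀ᶠ s in 𝓝[>] sstar, ψ s < 0 := by
      rcases (hgood_star.2).lt_or_eq with hlt0 | heq0
      · have hc : ContinuousWithinAt ψ (Icc t₀ t₁) sstar := hψc sstar hmem
        have h1 : ∀ᶠ s in 𝓝[Icc t₀ t₁] sstar, ψ s < 0 := hc.eventually (gt_mem_nhds hlt0)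
        have h3 : ∀ᶠ s in 𝓝[>] sstar, s ∈ Icc t₀ t₁ := by
          filter_upwards [Ioo_mem_nhdsGT hlt] with s hs
          exact ⟨le_trans hs0 hs.1.le, hs.2.le⟩
        have h4 : ∀ᶠ s in 𝓝 sstar, s ∈ Icc t₀ t₁ → ψ s < 0 := eventually_nhdsWithin_iff.1 h1
        filter_upwards [h3, nhdsWithin_le_nhds h4] with s hs hs'
        exact hs' hs
      · -- tight: the point is in the absolute band, the deficit makes `ψ′ ≤ k − a₀ < 0`
        have hℛeq : ℛ sstar = -m sstar := by
          have : ψ sstar = ℛ sstar + m sstar := rfl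
          linarith
        have hband_lo : -κb ≤ ⟪Z sstar, W (Z sstar)⟫ := by
          show -κb ≤ ℛ sstar
          rw [hℛeq]; linarith
        have hband_hi : ⟪Z sstar, W (Z sstar)⟫ ≤ κb := by
          show ℛ sstar ≤ κb
          rw [hℛeq]; linarith
        have hdef' := hdef (Z sstar) hR₁le (hhigh sstar hmem) (hvort sstar hmem) hband_lo hband_hi
        have hψ' := hψd sstar hmem
        have hderiv_neg : -(‖W (Z sstar)‖ ^ 2 + γ * ⟪Z sstar, W (Z sstar)⟫ + ⟪Z sstar, fderiv ℝ V (Z sstar) (W (Z sstar))⟫) + k < 0 := by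
          linarith
        have hev := BandClock.eventually_lt_right_of_hasDerivAt_neg hψ' hderiv_neg
        rw [heq0] at hev
        exact hev
    -- (2) choose `ε > 0` with `(sstar, sstar + ε) ⊆ {ψ < 0} ∩ (sstar, t₁)`
    have hev2 : ∀ᶠ s in 𝓝[>] sstar, ψ s < 0 ∧ s < t₁ :=
      hψneg.and (Filter.eventually_of_mem (Ioo_mem_nhdsGT hlt) fun s hs => hs.2)
    obtain ⟨b, hb, hbsub⟩ := (mem_nhdsGT_iff_exists_Ioo_subset).1 hev2
    set ε : ℝ := (min b t₁ - sstar) / 2 with hεdef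
    have hεpos : 0 < ε := by
      have : sstar < min b t₁ := lt_min hb hlt
      rw [hεdef]; linarith
    have hεb : sstar + ε < b := by
      have : min b t₁ ≤ b := min_le_left _ _
      rw [hεdef]; linarith
    have hεt : sstar + ε < t₁ := by
      have : min b t₁ ≤ t₁ := min_le_right _ _
      rw [hεdef]; linarith
    have hψle : ∀ s ∈ Icc sstar (sstar + ε), ψ s ≤ 0 := by
      intro s hs
      rcases hs.1.lt_or_eq with hl | he
      · exact (hbsub ⟨hl, lt_of_le_of_lt hs.2 hεb⟩).1.le
      · rw [← he]; exact hgood_star.2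
    -- (3) on `[sstar, sstar + ε]` the weighted radius `E = ‖Z‖² + 2κb(s−t₀)` is non-decreasing (`E′ = −2ℛ + 2κb ≥ 0`)
    have hsubI : Icc sstar (sstar + ε) ⊆ Icc t₀ t₁ := fun s hs => ⟨le_trans hs0 hs.1, le_trans hs.2 hεt.le⟩
    have hEmono : MonotoneOn E (Icc sstar (sstar + ε)) := by
      have hcont : ContinuousOn E (Icc sstar (sstar + ε)) := hEc.mono hsubI
      have hdiff : DifferentiableOn ℝ E (interior (Icc sstar (sstar + ε))) := by
        rw [interior_Icc]
        exact fun s hs => (hEd s (hsubI (Ioo_subset_Icc_self hs))).differentiableAt.differentiableWithinAt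
      refine monotoneOn_of_deriv_nonneg (convex_Icc _ _) hcont hdiff fun s hs => ?_
      rw [interior_Icc] at hs
      have hsI : s ∈ Icc sstar (sstar + ε) := Ioo_subset_Icc_self hs
      rw [(hEd s (hsubI hsI)).deriv, inner_neg_right]
      have hψs : ψ s ≤ 0 := hψle s hsI
      have hms : -κb ≤ m s := hm_ge s (le_trans hs0 hsI.1)
      have hℛle : ℛ s ≤ κb := by
        have e1 : ψ s = ℛ s + m s := rfl
        linarith
      have hℛ' : ⟪Z s, W (Z s)⟫ = ℛ s := rfl
      rw [hℛ']
      linarith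
    have hfloor : ∀ s ∈ Icc sstar (sstar + ε), N t₀ ≤ E s := by
      intro s hs
      exact le_trans hgood_star.1 (hEmono (left_mem_Icc.2 (by linarith)) hs hs.1)
    -- (4) so `sstar + ε ∈ G`: contradiction
    have hmemG : sstar + ε ∈ G := by
      refine ⟨⟨by linarith, hεt.le⟩, fun s' hs' => ?_⟩
      rcases le_or_gt s' sstar with hle | hgt
      · exact hgood_le s' ⟨hs'.1, hle⟩
      · exact ⟨hfloor s' ⟨hgt.le, hs'.2⟩, hψle s' ⟨hgt.le, hs'.2⟩⟩
    have := le_csSup hGbdd hmemG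
    linarith
  -- ### conclusion
  intro s hs
  have hsg : good s := hgood_le s ⟨hs.1, by rw [hstar]; exact hs.2⟩
  exact ⟨hsg.1, hsg.2⟩

/-- **ABSOLUTE NO RETURN AFTER SLOW OUTFLOW** (see the module docstring).  `V ∈ C¹`; FULL ABSOLUTE BAND deficit beyond `R₁` (`κb, a₀ > 0`); backward arc
`Z′ = −W(Z)` on `[t₀, t₁]`, high and vortical throughout, starting with `ℛ(Z t₀) ≤ κb` (slow outflow or any inflow) and `R₁² + 4κb²/a₀ ≤ ‖Z t₀‖²`.
Then for all `s ∈ [t₀, t₁]`: `‖Z t₀‖² − 4κb²/a₀ ≤ ‖Z s‖²` (the arc never enters `B(0, R₁)`), and `ℛ(Z s) ≤ 0` once `s ≥ t₀ + 2κb/a₀`. [folklore] -/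
theorem abs_noReturn (hV : ContDiff ℝ 1 V) {κb a₀ R₁ h t₀ t₁ : ℝ} (hκb : 0 < κb) (ha₀ : 0 < a₀) (hR₁ : 0 < R₁) (ht : t₀ ≤ t₁)
    (hdef : ∀ y : EuclideanSpace ℝ (Fin 3), R₁ ≤ ‖y‖ → h < selfSimilarBernoulli γ 0 V P' y → curl V y ≠ 0 →
      -κb ≤ ⟪y, selfSimilarTransport γ 0 V y⟫ → ⟪y, selfSimilarTransport γ 0 V y⟫ ≤ κb →
      a₀ ≤ ‖selfSimilarTransport γ 0 V y‖ ^ 2 + γ * ⟪y, selfSimilarTransport γ 0 V y⟫ +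
        ⟪y, fderiv ℝ V y (selfSimilarTransport γ 0 V y)⟫)
    {Z : ℝ → EuclideanSpace ℝ (Fin 3)}
    (hZ : ∀ s ∈ Icc t₀ t₁, HasDerivAt Z (-(selfSimilarTransport γ 0 V (Z s))) s)
    (hhigh : ∀ s ∈ Icc t₀ t₁, h < selfSimilarBernoulli γ 0 V P' (Z s))
    (hvort : ∀ s ∈ Icc t₀ t₁, curl V (Z s) ≠ 0)
    (hZ0 : R₁ ^ 2 + 4 * κb ^ 2 / a₀ ≤ ‖Z t₀‖ ^ 2)
    (hrate0 : ⟪Z t₀, selfSimilarTransport γ 0 V (Z t₀)⟫ ≤ κb) :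
    ∀ s ∈ Icc t₀ t₁, ‖Z t₀‖ ^ 2 - 4 * κb ^ 2 / a₀ ≤ ‖Z s‖ ^ 2 ∧
      (t₀ + 2 * κb / a₀ ≤ s → ⟪Z s, selfSimilarTransport γ 0 V (Z s)⟫ ≤ 0) := by
  set T : ℝ := 2 * κb / a₀ with hTdef
  have hT : 0 < T := by positivity
  have hκT : 2 * κb * T = 4 * κb ^ 2 / a₀ := by rw [hTdef]; field_simp; try ring
  have haT : a₀ / 2 * T = κb := by rw [hTdef]; field_simp; try ring
  set s₁ : ℝ := min t₁ (t₀ + T) with hs₁def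
  have hs₁t : s₁ ≤ t₁ := min_le_left _ _
  have hs₁T : s₁ ≤ t₀ + T := min_le_right _ _
  have hts₁ : t₀ ≤ s₁ := le_min ht (by linarith)
  have hsub₀ : Icc t₀ s₁ ⊆ Icc t₀ t₁ := Icc_subset_Icc le_rfl hs₁t
  -- ### phase 0: the signed bootstrap with `m₀ = −κb`, `k = a₀/2` on `[t₀, s₁]`
  have hph0 := signed_abs_band_bootstrap (γ := γ) (P' := P') hV (t₀ := t₀) (t₁ := s₁) (m₀ := -κb) (k := a₀ / 2)
    hκb hR₁ hts₁ le_rfl (by positivity) (by linarith)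
    (by
      have h1 : a₀ / 2 * (s₁ - t₀) ≤ a₀ / 2 * T := mul_le_mul_of_nonneg_left (by linarith) (by positivity)
      linarith) hdef
    (fun s hs => hZ s (hsub₀ hs)) (fun s hs => hhigh s (hsub₀ hs)) (fun s hs => hvort s (hsub₀ hs))
    (by
      have h3 : 2 * κb * (s₁ - t₀) ≤ 2 * κb * T := mul_le_mul_of_nonneg_left (by linarith) (by linarith)
      linarith)
    (by linarith)
  have hfloor0 : ∀ s ∈ Icc t₀ s₁, ‖Z t₀‖ ^ 2 - 4 * κb ^ 2 / a₀ ≤ ‖Z s‖ ^ 2 := by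
    intro s hs
    have hE := (hph0 s hs).1
    have h3 : 2 * κb * (s - t₀) ≤ 2 * κb * T := mul_le_mul_of_nonneg_left (by linarith [hs.2]) (by linarith)
    linarith
  by_cases hlong : t₀ + T ≤ t₁
  · have hs₁eq : s₁ = t₀ + T := min_eq_right hlong
    have hsub₁ : Icc s₁ t₁ ⊆ Icc t₀ t₁ := Icc_subset_Icc hts₁ le_rfl
    have hrate₁ : ⟪Z s₁, selfSimilarTransport γ 0 V (Z s₁)⟫ ≤ 0 := by
      have h := (hph0 s₁ (right_mem_Icc.2 hts₁)).2
      have hm : -κb + a₀ / 2 * (s₁ - t₀) = 0 := by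
        have e : a₀ / 2 * (s₁ - t₀) = a₀ / 2 * T := by rw [hs₁eq]; ring
        linarith
      rw [hm, add_zero] at h
      exact h
    have hR₁s₁ : R₁ ≤ ‖Z s₁‖ := by
      have h2 : R₁ ^ 2 ≤ ‖Z s₁‖ ^ 2 := le_trans (by linarith) (hfloor0 s₁ (right_mem_Icc.2 hts₁))
      exact (pow_le_pow_iff_left₀ hR₁.le (norm_nonneg _) two_ne_zero).1 h2
    have hdef' : ∀ y : EuclideanSpace ℝ (Fin 3), R₁ ≤ ‖y‖ → h < selfSimilarBernoulli γ 0 V P' y → curl V y ≠ 0 →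
        -κb ≤ ⟪y, selfSimilarTransport γ 0 V y⟫ → ⟪y, selfSimilarTransport γ 0 V y⟫ ≤ 0 →
        a₀ ≤ ‖selfSimilarTransport γ 0 V y‖ ^ 2 + γ * ⟪y, selfSimilarTransport γ 0 V y⟫ +
          ⟪y, fderiv ℝ V y (selfSimilarTransport γ 0 V y)⟫ :=
      fun y hy hh hc hlo hhi => hdef y hy hh hc hlo (le_trans hhi hκb.le)
    have hph1 := abs_band_bootstrap (γ := γ) (P' := P') hV (t₀ := s₁) (t₁ := t₁) (m₀ := 0) (k := 0)
      hs₁t le_rfl le_rfl ha₀ (by simpa using hκb.le) hdef'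
      (fun s hs => hZ s (hsub₁ hs)) (fun s hs => hhigh s (hsub₁ hs)) (fun s hs => hvort s (hsub₁ hs))
      hR₁s₁ (by simpa using hrate₁)
    intro s hs
    rcases le_or_gt s s₁ with hle | hgt
    · refine ⟨hfloor0 s ⟨hs.1, hle⟩, fun hsT => ?_⟩
      have hseq : s = s₁ := le_antisymm hle (by rw [hs₁eq]; exact hsT)
      rw [hseq]; exact hrate₁
    · have h1 := hph1 s ⟨hgt.le, hs.2⟩
      have hsq : ‖Z s₁‖ ^ 2 ≤ ‖Z s‖ ^ 2 := pow_le_pow_left₀ (norm_nonneg _) h1.1 2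
      refine ⟨le_trans (hfloor0 s₁ (right_mem_Icc.2 hts₁)) hsq, fun _ => ?_⟩
      have h2 := h1.2
      simp only [zero_mul, add_zero] at h2
      exact h2
  · have hs₁eq : s₁ = t₁ := min_eq_left (le_of_lt (not_le.1 hlong))
    intro s hs
    refine ⟨hfloor0 s ⟨hs.1, by rw [hs₁eq]; exact hs.2⟩, fun hsT => ?_⟩
    exact absurd (le_trans hsT hs.2) hlong

end DriftClock

end Summit.NavierStokesRegularity.NavierStokesRegularity.Theorems.PowerGaugeEulerLiouville

end
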